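import Summits.Langlands.Langlands.Theses.HolomorphicLimitSplit

/-!
# Glue of the weight-one-bridge split of `HolomorphicLimitAutomorphy` (route HolomorphicLimitSplit)

Closes the glue item `HolomorphicLimitAutomorphy_of_wsplit : OddArtinTypeAutomorphy → OddWeightOneBridgeAutomorphy → PrimitivePartialWeightOneAutomorphy → LowRankDihedralLimitAutomorphy → RankFourModRankTwoAutomorphy → HolomorphicLimitAutomorphy` filed by
`ledger route edit route-Langlands-HolomorphicLimitSplit --split HolomorphicLimitAutomorphy --into children.json --glue-decl-name HolomorphicLimitAutomorphy_of_wsplit`.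
Pure logic (v3, answers crit-1 row 109) — excluded middles on the inlined dials (n = 4; n = 2 ∧ ρ totally odd ∧ (finite projective image ∨ HT-scalar ∨ quadratically primitive)) written as `by_contra`
continuations so that no dial is restated.  This is the decomp-langlands lens-5 g7 node kernel `WeightOneBridgeSplit.hl_of_sharp` (2026-08-30), certified as
`HolomorphicLimitAutomorphy_of_wsplit_proof` in `nodes/lens-5-g7-WeightOneBridgeSplit.kit_check_split.lean` against the born host module.  No definitions.
-/

set_option linter.dupNamespace false -- project-wide option; `Summit.Langlands.Langlands` is the mandated namespace

namespace Summit.Langlands.Langlands.Theorems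

open Summit.Langlands.Langlands.Theses.HolomorphicLimitSplit in
/-- The glue item of the weight-one-bridge split of `HolomorphicLimitAutomorphy` (HL_TR) on route HolomorphicLimitSplit: the children imply the parent. -/
theorem HolomorphicLimitAutomorphy_of_wsplit_proof :
    Summit.Langlands.Langlands.Theses.HolomorphicLimitSplit.HolomorphicLimitAutomorphy_of_wsplit := by
  intro hOA hOB hPW hLOW hR4 K _ _ hK n hcpt hn ℓ _ ι ρ hirr hgeo hn4 hpol hmult hnreg
  by_contra hno
  -- excluded middles on the inlined dials as `by_contra` continuations (no dial is restated); R4†'s hypothesis HL2 is produced as a goal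
  refine hno (hLOW K hK n hcpt hn ℓ ι ρ hirr hgeo hn4 hpol hmult hnreg (fun h4 => ?_) (fun hc => ?_))
  · refine hno (hR4 ?_ K hK n hcpt hn ℓ ι ρ hirr hgeo hn4 hpol hmult hnreg h4)
    intro K _ _ hK n hcpt hn ℓ _ ι ρ hirr hgeo hn4 hpol hmult hnreg h2
    by_contra hno
    refine hno (hLOW K hK n hcpt hn ℓ ι ρ hirr hgeo hn4 hpol hmult hnreg (by omega) fun hc => ?_)
    obtain ⟨h2', hodd, hfin | hsc | hprim⟩ := hc
    · exact hno (hOA K hK n hcpt hn ℓ ι ρ hirr hgeo hn4 hpol hmult hnreg h2' hodd hfin)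
    · exact hno (hOB K hK n hcpt hn ℓ ι ρ hirr hgeo hn4 hpol hmult hnreg h2' hodd hsc fun hfin => hno (hOA K hK n hcpt hn ℓ ι ρ hirr hgeo hn4 hpol hmult hnreg h2' hodd hfin))
    · exact hno (hPW K hK n hcpt hn ℓ ι ρ hirr hgeo hn4 hpol hmult hnreg h2' hodd (fun hsc => hno (hOB K hK n hcpt hn ℓ ι ρ hirr hgeo hn4 hpol hmult hnreg h2' hodd hsc fun hfin => hno (hOA K hK n hcpt hn ℓ ι ρ hirr hgeo hn4 hpol hmult hnreg h2' hodd hfin)))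
        (fun hfin => hno (hOA K hK n hcpt hn ℓ ι ρ hirr hgeo hn4 hpol hmult hnreg h2' hodd hfin)) hprim)
  · obtain ⟨h2', hodd, hfin | hsc | hprim⟩ := hc
    · exact hno (hOA K hK n hcpt hn ℓ ι ρ hirr hgeo hn4 hpol hmult hnreg h2' hodd hfin)
    · exact hno (hOB K hK n hcpt hn ℓ ι ρ hirr hgeo hn4 hpol hmult hnreg h2' hodd hsc fun hfin => hno (hOA K hK n hcpt hn ℓ ι ρ hirr hgeo hn4 hpol hmult hnreg h2' hodd hfin))
    · exact hno (hPW K hK n hcpt hn ℓ ι ρ hirr hgeo hn4 hpol hmult hnreg h2' hodd (fun hsc => hno (hOB K hK n hcpt hn ℓ ι ρ hirr hgeo hn4 hpol hmult hnreg h2' hodd hsc fun hfin => hno (hOA K hK n hcpt hn ℓ ι ρ hirr hgeo hn4 hpol hmult hnreg h2' hodd hfin)))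
        (fun hfin => hno (hOA K hK n hcpt hn ℓ ι ρ hirr hgeo hn4 hpol hmult hnreg h2' hodd hfin)) hprim)

end Summit.Langlands.Langlands.Theorems
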